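import Mathlib
import Literature.NumberTheory.LFunctions.Zhang2022.Section5DeltaRapidDecayTail
import Literature.NumberTheory.LFunctions.Zhang2022.Section7cStatements
import HarnessLib

/-!
# Zhang (2022), §7 (7.14) / §14 (14.8) with the exact Mellin weight: `|Σ_p a(p)Δ(c/p)| ≤ c⁻¹(1/2π)∫|δ(1+it)|·|Σ_p a(p)p^{1+it}|dt`, kernel-checked

Topic `Literature/NumberTheory/LFunctions/Zhang2022` (Landau–Siegel audit tree; verdict-neutral).
Y. Zhang, *Discrete mean estimates and the Landau–Siegel zero*, arXiv:2211.02515v1 (2022)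
[Zhang2022LandauSiegel] — **an unrefereed manuscript under adjudication** (cell `siegel-zhang`, D-0069).
DAG nodes `Z22:(7.14)` [Z22 p.38, tex L2009–2013] ("By the Mellin transform and Lemma 5.4 (i),
`Σ_{p∼P} p^{β₃}θ̄(p)Δ(l/(phr)) ≪ 𝓛ᶜhrl⁻¹∫|Σ_{p∼P}p^{1+it+β₃}θ̄(p)|dt/(1+t²)`", typed AS PRINTED as
`Section7cStatements.Eq714`) and `Z22:(14.8)` [Z22 p.82, tex L3945–3966] (the same step for
`Σ_{p∼P} χθ̄(p)Δ(l/(phr))`, "In a way similar to the proof of Proposition 7.1 … we use the Mellin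
transform, Lemma 5.4 (i) …", GAP-LEDGER G-adj2-4). The sentence after (7.14) (§7.u033) is where the
printed chain fails to aggregate (G-adj2-1/G-adj2-2, Teams B/R): the weight `𝓛ᶜ/(1+t²)` of Lemma 5.4 (i)
has forgotten that `δ(1+it)` is negligible for `|t| > D`. This file proves the PARENT inequality with the
exact weight `|δ(1+it)|`, for ARBITRARY coefficients:

* `Skeleton.norm_sum_primeWindow_mul_DeltaW_le` — for all large `D`, every `a : ℕ → ℂ`, every `c > 0`:
  `‖Σ_{p∼P} a(p)Δ(c/p)‖ ≤ c⁻¹·(1/2π)·∫ ‖δ(1+it)‖·‖Σ_{p∼P} a(p)p^{1+it}‖ dt`, with the integrand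
  integrable (`Skeleton.integrable_norm_deltaW_mul_norm_primeSum`) — from the Mellin inversion
  `Skeleton.DeltaW_eq_mellinInv` and `(c/p)^{−(1+it)} = (c⁻¹)^{1+it}p^{1+it}`;
* `Skeleton.norm_sum_primeWindow_DeltaW_le` — the (7.14) instance `a(p) = p^β θ̄(p)`, `c = l/(hr)`:
  `‖Σ_{p∼P} p^β θ̄(p)Δ(l/(phr))‖ ≤ (hr/l)·(1/2π)·∫‖δ(1+it)‖·‖Σ_{p∼P}θ̄(p)p^{1+it+β}‖dt`, whose left side
  at `β = β₃` is literally that of `Section7cStatements.Eq714` (`p`-sum = `Section7cStatements.pPoly`),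
  with `Skeleton.integrable_norm_deltaW_mul_norm_pPoly`.

* `Skeleton.eq714_holds` — **the PRINTED (7.14), `Section7cStatements.Eq714 c′`, HOLDS for every `c′`**
  (`k = 5190`; via `‖δ(1+it)‖ ≤ C𝓛⁵¹⁹⁰/(1+t²)`, `Skeleton.norm_deltaW_line_le`).

The REPAIRED §7.u033 / (14.8)-legs follow from the exact-weight form by splitting `|t| ≤ D` (Lemma 5.6,
tree `Skeleton.lemma56_holds`) / `|t| > D` (`Skeleton.deltaW_tail_integral_le`); that consumer step is
NOT done here. No claim about Prop. 7.1 / 14.1, Theorems 1–2, or Landau–Siegel zeros.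

## References

* Y. Zhang, arXiv:2211.02515v1 (2022), §7 (7.14) p.38; §14 (14.8) p.82; §5 (5.14), Lemma 5.4 (i) p.28.
  [cite: Zhang2022LandauSiegel, §7 (7.14); §14 (14.8)]
-/

noncomputable section

open Complex Real Set MeasureTheory Filter Topology
open Literature.NumberTheory.LFunctions.Zhang2022.Section7cStatements (pPoly)

namespace Literature.NumberTheory.LFunctions.Zhang2022.Skeleton

/-- `t ↦ x^{−(1+it)}` (`x > 0`) is continuous. [folklore] -/
private theorem continuous_cpow_neg_line {x : ℝ} (hx : 0 < x) :
    Continuous fun t : ℝ => (x : ℂ) ^ (-(1 + t * I)) := by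
  have hx0 : (x : ℂ) ≠ 0 := ofReal_ne_zero.mpr hx.ne'
  have h1 : Continuous fun b : ℂ => (x : ℂ) ^ b :=
    continuous_iff_continuousAt.mpr fun b => continuousAt_const_cpow hx0
  exact h1.comp (by fun_prop)

/-- `‖x^{−(1+it)}‖ = x⁻¹` for `x > 0`. [folklore] -/
private theorem norm_cpow_neg_line {x : ℝ} (hx : 0 < x) (t : ℝ) :
    ‖(x : ℂ) ^ (-(1 + t * I))‖ = x⁻¹ := by
  rw [Complex.norm_cpow_eq_rpow_re_of_pos hx]
  simp [Real.rpow_neg_one]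

/-- `t ↦ Σ_{p∼P} a(p)p^{1+it}` is continuous. [folklore] -/
private theorem continuous_primeSum_line (D : ℕ) (a : ℕ → ℂ) :
    Continuous fun t : ℝ => ∑ p ∈ primeWindow D, a p * (p : ℂ) ^ (1 + (t : ℂ) * I) := by
  refine continuous_finsetSum _ fun p hp => ?_
  have hp0 : ((p : ℕ) : ℂ) ≠ 0 := by
    have := (Finset.mem_filter.mp hp).2.pos
    exact_mod_cast this.ne'
  have h1 : Continuous fun b : ℂ => ((p : ℕ) : ℂ) ^ b :=
    continuous_iff_continuousAt.mpr fun b => continuousAt_const_cpow hp0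
  exact continuous_const.mul (h1.comp (by fun_prop))

/-- `‖Σ_{p∼P} a(p)p^{1+it}‖ ≤ Σ_{p∼P} ‖a(p)‖p`. [folklore] -/
private theorem norm_primeSum_line_le (D : ℕ) (a : ℕ → ℂ) (t : ℝ) :
    ‖∑ p ∈ primeWindow D, a p * (p : ℂ) ^ (1 + (t : ℂ) * I)‖ ≤ ∑ p ∈ primeWindow D, ‖a p‖ * p := by
  refine (norm_sum_le _ _).trans (Finset.sum_le_sum fun p hp => ?_)
  have hp : 0 < p := (Finset.mem_filter.mp hp).2.pos
  rw [norm_mul, Complex.norm_natCast_cpow_of_pos hp]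
  simp

/-- The Mellin kernel against the `p`-sum: `Σ_p a(p)(c/p)^{−s} = (c⁻¹)^{s}Σ_p a(p)p^{s}` (`s = 1+it`,
`c > 0`). [cite: Zhang2022LandauSiegel, §7 (7.14)] -/
private theorem sum_cpow_kernel_eq (D : ℕ) (a : ℕ → ℂ) {c : ℝ} (hc : 0 < c) (t : ℝ) :
    ∑ p ∈ primeWindow D, a p * (((c / p : ℝ)) : ℂ) ^ (-(1 + t * I))
      = ((c⁻¹ : ℝ) : ℂ) ^ (1 + (t : ℂ) * I) *
          ∑ p ∈ primeWindow D, a p * (p : ℂ) ^ (1 + (t : ℂ) * I) := by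
  rw [Finset.mul_sum]
  refine Finset.sum_congr rfl fun p hp => ?_
  have hp : 0 < p := (Finset.mem_filter.mp hp).2.pos
  set s : ℂ := 1 + (t : ℂ) * I with hs
  have hxpos : 0 < c / p := by positivity
  have harg : (((c / p : ℝ)) : ℂ).arg ≠ π := by
    rw [Complex.arg_ofReal_of_nonneg hxpos.le]; exact Real.pi_ne_zero.symm
  have e1 : (((c / p : ℝ)) : ℂ) ^ (-s) = ((c⁻¹ : ℝ) : ℂ) ^ s * ((p : ℕ) : ℂ) ^ s := by
    rw [Complex.cpow_neg, ← Complex.inv_cpow _ s harg, ← Complex.ofReal_inv, inv_div,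
      show (p : ℝ) / c = c⁻¹ * (p : ℝ) by rw [div_eq_mul_inv, mul_comm], Complex.ofReal_mul,
      Complex.mul_cpow_ofReal_nonneg (inv_nonneg.mpr hc.le) (Nat.cast_nonneg p)]
    norm_cast
  rw [e1]
  ring

/-- **The right-hand integrand with the exact Mellin weight is integrable**: for all large `D`, every
`a : ℕ → ℂ`, `t ↦ ‖δ(1+it)‖·‖Σ_{p∼P} a(p)p^{1+it}‖ ∈ L¹(ℝ)`. [cite: Zhang2022LandauSiegel, §7 (7.14)] -/
theorem integrable_norm_deltaW_mul_norm_primeSum :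
    ForAllLarge fun D _ _ => ∀ a : ℕ → ℂ,
      Integrable fun t : ℝ =>
        ‖deltaW D (1 + t * I)‖ * ‖∑ p ∈ primeWindow D, a p * (p : ℂ) ^ (1 + (t : ℂ) * I)‖ := by
  obtain ⟨D₀, h⟩ := integrable_deltaW_line
  refine ⟨D₀, fun D _ χ hD hq hp a => ?_⟩
  exact (h D χ hD hq hp).norm.mul_bdd (continuous_primeSum_line D a).norm.aestronglyMeasurable
    (Eventually.of_forall fun t => by
      rw [Real.norm_of_nonneg (norm_nonneg _)]; exact norm_primeSum_line_le D a t)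

/-- **(7.14)/(14.8) with the exact Mellin weight, arbitrary coefficients.** For all sufficiently large
`D` (and every real primitive `χ mod D`, vacuously), every `a : ℕ → ℂ` and every `c > 0`:
`‖Σ_{p∼P} a(p) Δ(c/p)‖ ≤ c⁻¹·(1/2π)·∫ ‖δ(1+it)‖·‖Σ_{p∼P} a(p)p^{1+it}‖ dt`
(`Δ = Skeleton.DeltaW D`, `δ = Skeleton.deltaW D`): "By the Mellin transform" made exact, BEFORE the
weight `|δ(1+it)|` is replaced by Lemma 5.4 (i)'s `𝓛ᶜ/(1+t²)`. [cite: Zhang2022LandauSiegel, §7 (7.14); §14 (14.8)] -/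
theorem norm_sum_primeWindow_mul_DeltaW_le :
    ForAllLarge fun D _ _ => ∀ (a : ℕ → ℂ) (c : ℝ), 0 < c →
      ‖∑ p ∈ primeWindow D, a p * DeltaW D (c / p)‖
        ≤ c⁻¹ * (1 / (2 * π)) *
            ∫ t : ℝ, ‖deltaW D (1 + t * I)‖ * ‖∑ p ∈ primeWindow D, a p * (p : ℂ) ^ (1 + (t : ℂ) * I)‖ := by
  obtain ⟨D₀, hall⟩ := DeltaW_eq_mellinInv.and integrable_deltaW_line
  refine ⟨D₀, fun D _ χ hD hq hp a c hc => ?_⟩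
  obtain ⟨hinv, hint⟩ := hall D χ hD hq hp
  -- Step 1: insert the Mellin inversion for each `p` and interchange sum and integral.
  have hFint : ∀ p ∈ primeWindow D, Integrable fun t : ℝ =>
      a p * ((((c / p : ℝ)) : ℂ) ^ (-(1 + t * I)) * deltaW D (1 + t * I)) := by
    intro p hp
    have hpp : 0 < p := (Finset.mem_filter.mp hp).2.pos
    have hx : 0 < c / p := by positivity
    exact (hint.bdd_mul (continuous_cpow_neg_line hx).aestronglyMeasurable
      (Eventually.of_forall fun t => (norm_cpow_neg_line hx t).le)).const_mul _
  have hsum : ∑ p ∈ primeWindow D, a p * DeltaW D (c / p)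
      = ((1 / (2 * π) : ℝ) : ℂ) * ∫ t : ℝ, ∑ p ∈ primeWindow D,
          a p * ((((c / p : ℝ)) : ℂ) ^ (-(1 + t * I)) * deltaW D (1 + t * I)) := by
    rw [integral_finsetSum _ hFint, Finset.mul_sum]
    refine Finset.sum_congr rfl fun p hp => ?_
    have hpp : 0 < p := (Finset.mem_filter.mp hp).2.pos
    have hx : 0 < c / p := by positivity
    rw [hinv _ hx, integral_const_mul (a p), Complex.real_smul]
    simp_rw [smul_eq_mul]
    ring
  -- Step 2: the integrand is `(c⁻¹)^{1+it}·(Σ_p a(p)p^{1+it})·δ(1+it)`, of norm `c⁻¹‖δ‖‖Σ‖`.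
  have hnorm : ∀ t : ℝ, ‖∑ p ∈ primeWindow D,
        a p * ((((c / p : ℝ)) : ℂ) ^ (-(1 + t * I)) * deltaW D (1 + t * I))‖
      = c⁻¹ * (‖deltaW D (1 + t * I)‖ *
          ‖∑ p ∈ primeWindow D, a p * (p : ℂ) ^ (1 + (t : ℂ) * I)‖) := by
    intro t
    have e : ∑ p ∈ primeWindow D, a p * ((((c / p : ℝ)) : ℂ) ^ (-(1 + t * I)) * deltaW D (1 + t * I))
        = (∑ p ∈ primeWindow D, a p * (((c / p : ℝ)) : ℂ) ^ (-(1 + t * I))) * deltaW D (1 + t * I) := by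
      rw [Finset.sum_mul]
      exact Finset.sum_congr rfl fun p _ => by ring
    have hre : ((1 : ℂ) + (t : ℂ) * I).re = 1 := by simp
    rw [e, sum_cpow_kernel_eq D a hc t, norm_mul, norm_mul,
      Complex.norm_cpow_eq_rpow_re_of_pos (inv_pos.mpr hc), hre, Real.rpow_one]
    ring
  have h2π : 0 ≤ (1 / (2 * π) : ℝ) := by positivity
  calc ‖∑ p ∈ primeWindow D, a p * DeltaW D (c / p)‖
      = (1 / (2 * π)) * ‖∫ t : ℝ, ∑ p ∈ primeWindow D,
          a p * ((((c / p : ℝ)) : ℂ) ^ (-(1 + t * I)) * deltaW D (1 + t * I))‖ := by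
        rw [hsum, norm_mul, Complex.norm_real, Real.norm_of_nonneg h2π]
    _ ≤ (1 / (2 * π)) * ∫ t : ℝ, ‖∑ p ∈ primeWindow D,
          a p * ((((c / p : ℝ)) : ℂ) ^ (-(1 + t * I)) * deltaW D (1 + t * I))‖ :=
        mul_le_mul_of_nonneg_left (norm_integral_le_integral_norm _) h2π
    _ = c⁻¹ * (1 / (2 * π)) * ∫ t : ℝ, ‖deltaW D (1 + t * I)‖ *
          ‖∑ p ∈ primeWindow D, a p * (p : ℂ) ^ (1 + (t : ℂ) * I)‖ := by
        simp_rw [hnorm]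
        rw [integral_const_mul]
        ring

/-- The (7.14) coefficients: `Σ_{p∼P} (p^β θ̄(p))·p^{1+it} = Σ_{p∼P} θ̄(p)p^{1+it+β}` (= `pPoly D r θ (1+it+β)`).
[cite: Zhang2022LandauSiegel, §7 (7.14)] -/
theorem primeSum_twist_eq_pPoly (D r : ℕ) (θ : DirichletCharacter ℂ r) (β : ℂ) (t : ℝ) :
    ∑ p ∈ primeWindow D, ((p : ℂ) ^ β * θ⁻¹ (p : ZMod r)) * (p : ℂ) ^ (1 + (t : ℂ) * I)
      = pPoly D r θ (1 + t * I + β) := by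
  unfold pPoly
  refine Finset.sum_congr rfl fun p hp => ?_
  have hp : 0 < p := (Finset.mem_filter.mp hp).2.pos
  conv_rhs => rw [Complex.cpow_add _ _ (by exact_mod_cast hp.ne')]
  ring

/-- **The (7.14) integrand with the exact Mellin weight is integrable**: for all large `D`, every `r`,
`θ (mod r)`, `β`, `t ↦ ‖δ(1+it)‖·‖Σ_{p∼P}θ̄(p)p^{1+it+β}‖ ∈ L¹(ℝ)`. [cite: Zhang2022LandauSiegel, §7 (7.14)] -/
theorem integrable_norm_deltaW_mul_norm_pPoly :
    ForAllLarge fun D _ _ => ∀ (r : ℕ) (θ : DirichletCharacter ℂ r) (β : ℂ),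
      Integrable fun t : ℝ => ‖deltaW D (1 + t * I)‖ * ‖pPoly D r θ (1 + t * I + β)‖ := by
  obtain ⟨D₀, h⟩ := integrable_norm_deltaW_mul_norm_primeSum
  refine ⟨D₀, fun D _ χ hD hq hp r θ β => ?_⟩
  have h1 := h D χ hD hq hp fun p => (p : ℂ) ^ β * θ⁻¹ (p : ZMod r)
  simp_rw [primeSum_twist_eq_pPoly] at h1
  exact h1

/-- **(7.14) with the exact Mellin weight.** For all sufficiently large `D` (and every real primitive
`χ mod D`, vacuously), every `r, h, l ≥ 1`, every Dirichlet character `θ (mod r)` and every `β : ℂ`: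
`‖Σ_{p∼P} p^β θ̄(p) Δ(l/(phr))‖ ≤ (hr/l)·(1/2π)·∫ ‖δ(1+it)‖·‖Σ_{p∼P} θ̄(p)p^{1+it+β}‖ dt`
(`Δ = Skeleton.DeltaW D`, `δ = Skeleton.deltaW D`; the `p`-sum is `Section7cStatements.pPoly`); with
`β = β₃` its left side is literally that of `Section7cStatements.Eq714`.
[cite: Zhang2022LandauSiegel, §7 (7.14)] -/
theorem norm_sum_primeWindow_DeltaW_le :
    ForAllLarge fun D _ _ => ∀ (r h l : ℕ) (θ : DirichletCharacter ℂ r) (β : ℂ),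
      0 < r → 0 < h → 0 < l →
        ‖∑ p ∈ primeWindow D, (p : ℂ) ^ β * θ⁻¹ (p : ZMod r) *
            DeltaW D ((l : ℝ) / ((p : ℝ) * h * r))‖
          ≤ (((h * r : ℕ) : ℝ) / l) * (1 / (2 * π)) *
              ∫ t : ℝ, ‖deltaW D (1 + t * I)‖ * ‖pPoly D r θ (1 + t * I + β)‖ := by
  obtain ⟨D₀, hall⟩ := norm_sum_primeWindow_mul_DeltaW_le
  refine ⟨D₀, fun D _ χ hD hq hp r h l θ β hr hh hl => ?_⟩
  have hc : 0 < (l : ℝ) / ((h * r : ℕ) : ℝ) := by positivity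
  have h1 := hall D χ hD hq hp (fun p => (p : ℂ) ^ β * θ⁻¹ (p : ZMod r)) _ hc
  simp_rw [primeSum_twist_eq_pPoly] at h1
  have e1 : ∀ p : ℕ, (l : ℝ) / ((h * r : ℕ) : ℝ) / p = (l : ℝ) / ((p : ℝ) * h * r) := by
    intro p; push_cast; rw [div_div]; ring_nf
  have e2 : ((l : ℝ) / ((h * r : ℕ) : ℝ))⁻¹ = ((h * r : ℕ) : ℝ) / l := inv_div _ _
  simp_rw [e1, e2] at h1
  exact h1

/-- **(7.14) as printed holds**: `Section7cStatements.Eq714 c′` for every `c′` (exponent `k = 5190`,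
no (A) used, unconditional in `χ`) — from the exact-weight inequality `norm_sum_primeWindow_DeltaW_le`
and Lemma 5.4 (i) on the line `σ = 1` (`norm_deltaW_line_le`: `‖δ(1+it)‖ ≤ K𝓛⁵¹⁹⁰/(1+t²)`) under the
integral. So the printed (7.14) is TRUE; what does not follow as printed is the next sentence (§7.u033 →
the `1 < r < D` aggregation, GAP-LEDGER G-adj2-1/G-adj2-2). [cite: Zhang2022LandauSiegel, §7 (7.14)] -/
theorem eq714_holds (c' : ℝ) : Section7cStatements.Eq714 c' := by
  set K : ℝ := (2 * Lemma53.Jconst 1 2 + 4 * ((2 + Real.exp 1) * (4 * π) ^ 2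
      * Real.exp (((5 : ℕ) : ℝ) ^ 2) + (Real.exp 1 * ((2 * 5).factorial : ℝ) + 5 ^ 5)
      * Lemma53.Jconst 1 2)) with hK
  have hJ0 : 0 ≤ Lemma53.Jconst 1 2 := Lemma53.Jconst_nonneg' 1 2
  have hK0 : 0 ≤ K := by positivity
  obtain ⟨D₀, h⟩ := norm_sum_primeWindow_DeltaW_le.and integrable_norm_deltaW_mul_norm_pPoly
  refine ⟨5190, K * (1 / (2 * π)), max D₀ 3, fun D _ χ hD hq hp _ r h' l θ hr hh hl _ => ?_⟩
  have hD3 : 3 ≤ D := le_trans (le_max_right _ _) hD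
  obtain ⟨hmain, hint⟩ := h D χ (le_trans (le_max_left _ _) hD) hq hp
  have h1 := hmain r h' l θ (beta3 c' D) hr hh hl
  have hℓ0 : 0 ≤ ell D := by
    have : 1 ≤ ell D := by
      rw [ell, Real.le_log_iff_exp_le (by exact_mod_cast (show 0 < D by omega))]
      have h3 : (3 : ℝ) ≤ D := by exact_mod_cast hD3
      linarith [Real.exp_one_lt_d9]
    linarith
  -- the `p`-polynomial is continuous and bounded in `t`
  have hcont : Continuous fun t : ℝ => pPoly D r θ (1 + t * I + beta3 c' D) := by
    have := continuous_primeSum_line D (fun p => (p : ℂ) ^ beta3 c' D * θ⁻¹ (p : ZMod r))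
    simp_rw [primeSum_twist_eq_pPoly] at this
    exact this
  have hbd : ∀ t : ℝ, ‖pPoly D r θ (1 + t * I + beta3 c' D)‖
      ≤ ∑ p ∈ primeWindow D, ‖(p : ℂ) ^ beta3 c' D * θ⁻¹ (p : ZMod r)‖ * p := fun t => by
    have := norm_primeSum_line_le D (fun p => (p : ℂ) ^ beta3 c' D * θ⁻¹ (p : ZMod r)) t
    simp_rw [primeSum_twist_eq_pPoly] at this
    exact this
  -- compare the two weights under the integral
  have hbdd : Integrable fun t : ℝ => (1 + t ^ 2)⁻¹ * ‖pPoly D r θ (1 + t * I + beta3 c' D)‖ :=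
    integrable_inv_one_add_sq.mul_bdd hcont.norm.aestronglyMeasurable
      (Eventually.of_forall fun t => by rw [Real.norm_of_nonneg (norm_nonneg _)]; exact hbd t)
  have hmaj : Integrable fun t : ℝ =>
      K * ell D ^ 5190 * ((1 + t ^ 2)⁻¹ * ‖pPoly D r θ (1 + t * I + beta3 c' D)‖) :=
    hbdd.const_mul _
  have hle : ∫ t : ℝ, ‖deltaW D (1 + t * I)‖ * ‖pPoly D r θ (1 + t * I + beta3 c' D)‖
      ≤ K * ell D ^ 5190 * ∫ t : ℝ, ‖pPoly D r θ (1 + t * I + beta3 c' D)‖ / (1 + t ^ 2) := by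
    calc ∫ t : ℝ, ‖deltaW D (1 + t * I)‖ * ‖pPoly D r θ (1 + t * I + beta3 c' D)‖
        ≤ ∫ t : ℝ, K * ell D ^ 5190 * ((1 + t ^ 2)⁻¹ * ‖pPoly D r θ (1 + t * I + beta3 c' D)‖) := by
          refine integral_mono (hint r θ _) hmaj fun t => ?_
          have := norm_deltaW_line_le hD3 t
          calc ‖deltaW D (1 + t * I)‖ * ‖pPoly D r θ (1 + t * I + beta3 c' D)‖
              ≤ K * ell D ^ 5190 * (1 + t ^ 2)⁻¹ * ‖pPoly D r θ (1 + t * I + beta3 c' D)‖ :=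
                mul_le_mul_of_nonneg_right this (norm_nonneg _)
            _ = _ := by ring
      _ = K * ell D ^ 5190 * ∫ t : ℝ, ‖pPoly D r θ (1 + t * I + beta3 c' D)‖ / (1 + t ^ 2) := by
          rw [integral_const_mul]
          congr 1
          exact integral_congr_ae (Eventually.of_forall fun t => by
            simp only [div_eq_mul_inv, mul_comm])
  calc ‖∑ p ∈ primeWindow D, (p : ℂ) ^ beta3 c' D * θ⁻¹ (p : ZMod r) *
          DeltaW D ((l : ℝ) / ((p : ℝ) * h' * r))‖
      ≤ (((h' * r : ℕ) : ℝ) / l) * (1 / (2 * π)) *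
          ∫ t : ℝ, ‖deltaW D (1 + t * I)‖ * ‖pPoly D r θ (1 + t * I + beta3 c' D)‖ := h1
    _ ≤ (((h' * r : ℕ) : ℝ) / l) * (1 / (2 * π)) *
          (K * ell D ^ 5190 * ∫ t : ℝ, ‖pPoly D r θ (1 + t * I + beta3 c' D)‖ / (1 + t ^ 2)) :=
        mul_le_mul_of_nonneg_left hle (by positivity)
    _ = K * (1 / (2 * π)) * ell D ^ (5190 : ℕ) * ((((h' * r : ℕ) : ℝ)) / l) *
          ∫ t : ℝ, ‖pPoly D r θ (1 + t * I + beta3 c' D)‖ / (1 + t ^ 2) := by ring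

end Literature.NumberTheory.LFunctions.Zhang2022.Skeleton
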